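import Summits.FinalStateConjecture.FinalStateConjecture.Theorems.LogTimeThreeAnnuliSubconvergentEraGenericOfSettledAllOrders
import Summits.FinalStateConjecture.FinalStateConjecture.Theorems.PhotonSphereChannelsChannelsResolveTameDevelopmentsRMinkowskiMaximal
import Summits.FinalStateConjecture.FinalStateConjecture.Theorems.ZeroEnergyKerrOrBombStationaryLimitReductionOneDevelopment
import Summits.FinalStateConjecture.FinalStateConjecture.Theorems.PhaseMixingCaptureWeakCosmicCensorshipMGHDCompleteNullInfinityInvariant
import Summits.FinalStateConjecture.FinalStateConjecture.Theorems.EIHFluxBalanceModulatedKerrHandoffStubRaysStayInClosureTransport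
import Summits.FinalStateConjecture.FinalStateConjecture.Theorems.EIHFluxBalanceModulatedKerrHandoffStubRayTransport
import Literature.Geometry.Lorentzian.TrivialDataAdmissible
import HarnessLib

/-!
# Crux `LogTimeThreeAnnuli.SubconvergentEraGeneric` (stmt-FinalStateConjecture-17490): the crux's property HOLDS on the
# whole MGHD fibre over the trivial datum — anti-vacuity of the existential side at a certified maximal development

Lead c5 of line `registered` (2026-08-17), `--supports` piece of stmt-FinalStateConjecture-17490.

The property whose tame genericity the crux asserts is
`P D :=` "every maximal vacuum Cauchy development of `D` has complete `𝓘⁺` AND carries the honest subconvergent final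
era" — thirteen clauses: `QuasiFinalStateDecomposition … O 2 ⊤`, `O = exteriorOf charted`, `RaysStayInClosure O`,
honest radii, causal exhaustion, orthochronous motions, `(M,a)`-uniform COVECTOR chart-time orientation, flat `∂₀`
future-directed, flat zone `→ η` in EVERY `Cᵏ`, windowed `Cᵏ`-closeness (every `k`) on fixed and growing near-zone slabs
to a wandering member of a compact sub-extremal window.  The crux-attack refuter (VETTING.md §3) and lead c2
(K_HONESTY_AUDIT.md §2) argued ON PAPER that `P(trivialData)` is "plausibly true (identity flat chart era)", so that the
crux admits no cheap refutation through a typed defect of its existential side.  This file makes that a theorem,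
unconditionally and for the WHOLE fibre of maximal developments:

* `subconvergentEraProperty_trivialData` — **for every maximal vacuum Cauchy development `𝒟` of the trivial datum
  `(ℝ³, δ, 0)`, `𝒟` has complete `𝓘⁺` and carries the crux's era** (all orders, covector gauge, verbatim).  Proof:
  `𝒟` is isometric as a development to Minkowski space (`Minkowski.isIsometricTo_vacuumCauchyDevelopment_of_isMaximal`,
  unconditional: Minkowski space is geodesically complete, so its CBG embedding into `𝒟` is onto); the honest `N = 0`
  decomposition `UniversalWitnessFamily.Negative.minkowskiDecomp` (identity flat chart on all of `E4`, `O = {x⁰ ≥ 0}`)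
  is pushed forward along the isometry (`OneLockedExplosion.transportDecomposition`); `O = exteriorOf`, rays, exhaustion
  and orientation ride along exactly as in `ChannelsResolveTameDevelopmentsR.TrivialDatum.settlesT2_of_isMaximal` and
  `DrainImpliesDisperse.Negative.exists_dispersiveDecomposition_of_isMaximal` (whose `∃`-form at order `2` cannot be
  reused: the all-orders clause needs the transported chart itself); the
  flat deviation of the transported chart is that of the identity chart (`OneLockedExplosion.deviationCk_comp`), i.e.
  ZERO AT EVERY ORDER; the hole-indexed clauses are vacuous (`N = 0`); and the landed pointwise adapter
  `era_of_settledAllOrders` (lead c4, p156598) turns this all-orders Statement-vocabulary settling into the era.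
* `trivialData_not_exceptional` — hence the trivial datum is NOT in the exceptional set
  `{d ∈ admissibleVacuumData ℝ³ | ¬ P d}` of the crux (`X = Minkowski.slice`).
* `exists_admissible_isMaximal_subconvergentEraProperty` — given the Choquet-Bruhat–Geroch existence theorem (for the
  anti-vacuity conjunct `∃ MGHD` only), an admissible datum with an MGHD at which `P` holds: the conclusion predicate of
  the crux — and of the registered residual stub C₂' `stub_subconvergentEraAlongCensoredKerrEnds`, whose hand-back curves
  must consist of `P`-data — is inhabited at a certified maximal development.

Consequence for the line (recorded in LINE-STATE-c5.md): a refutation of stmt-17490 (or of the promoted C₂') needs a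
NON-FLAT admissible datum with a certified maximal development violating `P` robustly along tame curves — censorship /
final-state physics plus an MGHD-existence input; no clause of the era is a typed defect.

No `sorry`; imports are landed Theorems modules and Literature.  References: Choquet-Bruhat–Geroch, CMP 14 (1969),
Thm. 3; Ringström 2009, Thm. 16.6; O'Neill 1983, Ch. 5 p. 145; Christodoulou–Klainerman 1993, Thm. 1.0.2;
Dafermos–Luk arXiv:1710.01722, Conjecture 1; Christodoulou, CQG 16 (1999) A23, p. A24.
-/

noncomputable section

-- the doubled `FinalStateConjecture` path component is the summit/problem naming scheme
set_option linter.dupNamespace false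

namespace Summit.FinalStateConjecture.FinalStateConjecture.Theorems.LogTimeThreeAnnuli.SubconvergentEraGeneric

open scoped Manifold ContDiff Topology ENNReal
open Filter Set Function Literature.Geometry.Lorentzian Literature.Geometry.Lorentzian.Minkowski
open Summit.FinalStateConjecture (HasCompleteNullInfinity exteriorOf RaysStayInClosure IsOrthochronous IsFutureOriented
  certifiedLate certifiedSlab HasExhaustiveCharts)
open Summit.FinalStateConjecture.FinalStateConjecture.Theorems.UniversalWitnessFamily.Negative
  (minkowskiExterior minkowskiDecomp idFlatChart minkowskiExterior_eq_exteriorOf hasExhaustiveCharts_minkowskiDecomp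
    deviationExtend_idFlatChart)
open Summit.FinalStateConjecture.FinalStateConjecture.Theorems.ChannelsResolveTameDevelopmentsR.TrivialDatum
  (raysStayInClosure_minkowski isFutureOriented_minkowskiDecomp)
open Summit.FinalStateConjecture.FinalStateConjecture.Theorems.OneLockedExplosion
  (transportDecomposition charted_transportDecomposition mdifferentiable_diffeomorph image_exteriorOf
    hasExhaustiveCharts_transportDecomposition deviationCk_comp)
open Summit.FinalStateConjecture.FinalStateConjecture.Theorems.PhaseMixingCapture.WeakCosmicCensorshipMGHD
  (hasCompleteNullInfinity_iff_of_isIsometricTo)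
open Summit.FinalStateConjecture.FinalStateConjecture.Theorems.EIHFluxBalance.TameTemplate
  (stub_raysStayInClosure_transport stub_rayTransport)

/-! ### The identity flat chart has zero deviation at every order -/

/-- **The identity flat chart of Minkowski space has zero `Cᵏ` deviation from `η` on every slab, for EVERY `k`**
(its extended deviation vanishes identically, `deviationExtend_idFlatChart`).  [cite: ChristodoulouKlainerman1993, Thm. 1.0.2] -/
theorem deviationCk_idFlatChart_eq_zero (k : ℕ) (τ : ℝ) :
    Minkowski.spacetime.deviationCk (Minkowski.backgroundOn ⊤) idFlatChart k τ = 0 := by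
  rw [Spacetime.deviationCk, deviationExtend_idFlatChart, supCkENorm_zero]

/-! ### The crux's property on the fibre over the trivial datum -/

/-- **THE CRUX'S PROPERTY HOLDS AT THE TRIVIAL DATUM, FOR EVERY MGHD** (unconditional).  For every maximal vacuum Cauchy
development `𝒟` of `(ℝ³, δ, 0)`: complete `𝓘⁺` and the honest subconvergent final era of
`LogTimeThreeAnnuli.SubconvergentEraGeneric`, verbatim (all orders, covector gauge).  `𝒟` is isometric as a development
to Minkowski space (`Minkowski.isIsometricTo_vacuumCauchyDevelopment_of_isMaximal`); complete `𝓘⁺` is an invariant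
(`hasCompleteNullInfinity_iff_of_isIsometricTo`); the honest `N = 0` decomposition `minkowskiDecomp` is transported
(`transportDecomposition`: `ψ(O) = exteriorOf 𝒟 ψ(charted)` by `image_exteriorOf`, rays by the ray correspondence,
exhaustion by `hasExhaustiveCharts_transportDecomposition`, orientation by the chain rule and O'Neill's timecone lemma `PreservesTimeOrientation.isFutureDirected_mfderiv`); its
flat deviation is that of the identity chart, zero at every order (`deviationCk_comp`, `deviationCk_idFlatChart_eq_zero`);
the hole clauses are vacuous; and `era_of_settledAllOrders` (p156598) yields the era.
[cite: Ringstrom2009, Thm. 16.6] [cite: ChristodoulouKlainerman1993, Thm. 1.0.2] -/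
theorem subconvergentEraProperty_trivialData : ∀ 𝒟 : VacuumCauchyDevelopment trivialData, 𝒟.IsMaximal → HasCompleteNullInfinity 𝒟.toCauchyDevelopment ∧ (∃ (m₀ χ : ℝ) (O : Set 𝒟.carrier) (d : QuasiFinalStateDecomposition 𝒟.toSpacetime O 2 ⊤) (R : Fin d.N → ℝ → ℝ), 0 < m₀ ∧ χ < 1 ∧ O = exteriorOf 𝒟.toCauchyDevelopment d.charted ∧ RaysStayInClosure 𝒟.toCauchyDevelopment O ∧ (∀ i, Tendsto (R i) atTop atTop ∧ ∀ τ, max (Kerr.rPlus (d.mass i) (d.spin i)) 0 + 1 ≤ R i τ) ∧ (∀ τ₁, d.τ₀ < τ₁ → O \ d.certifiedLate R τ₁ ⊆ 𝒟.metric.causalPast 𝒟.timeOrientation (d.certifiedSlab R τ₁)) ∧ (∀ i, IsOrthochronous (d.motion i).1) ∧ (∀ i (ρ : ℝ), ∀ᶠ τ in atTop, ∀ x ∈ (d.background i).truncTimeSlab ρ τ, ∀ w : E4, 𝒟.timeOrientation.IsFutureDirected (mfderiv 𝓘(ℝ, E4) (𝓡 4) (d.chart i) x w) → 0 < ((d.motion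 i).1 : E4 ≃L[ℝ] E4).symm w 0) ∧ (∀ᶠ τ in atTop, ∀ x ∈ (Minkowski.backgroundOn d.flatDomain).timeSlab τ, 𝒟.timeOrientation.IsFutureDirected (mfderiv 𝓘(ℝ, E4) (𝓡 4) d.flatChart x (E4.basisVector 0))) ∧ (∀ k, Tendsto (fun τ => 𝒟.toSpacetime.deviationCk (Minkowski.backgroundOn d.flatDomain) d.flatChart k τ) atTop (𝓝 0)) ∧ (∀ i k (ρ : ℝ) (ε : ℝ≥0∞), 0 < ε → ∀ᶠ τ in atTop, ∃ M a, m₀ ≤ M ∧ M ≤ m₀⁻¹ ∧ |a| ≤ χ * M ∧ 𝒟.toSpacetime.truncDeviationCk ⟨(d.background i).domain, boostedKerrBilin (d.motion i).1 (d.motion i).2 M a, (d.background i).time, (d.background i).radius⟩ (d.chart i) k ρ τ ≤ ε ∧ 𝒟.toSpacetime.truncDeviationCk ⟨(d.background i).domain, boostedKerrBilin (d.motion i).1 (d.motion i).2 M a, (d.background i).time, (d.background i).radius⟩ (d.chart i) k (R i τ) τ ≤ ε)) := by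
  intro 𝒟 hmax
  have h := Minkowski.isIsometricTo_vacuumCauchyDevelopment_of_isMaximal hmax
  refine ⟨(hasCompleteNullInfinity_iff_of_isIsometricTo _ _ h).1
    WeakCosmicCensorshipMGHD.Negative.minkowski_hasCompleteNullInfinity, ?_⟩
  obtain ⟨ψ, hiso, hτ, hι⟩ := h
  -- the transported honest `N = 0` decomposition of `ψ(O)`, `O = {x⁰ ≥ 0}`
  set d₂ : FinalStateDecomposition 𝒟.toSpacetime (ψ '' minkowskiExterior) 2 :=
    transportDecomposition (𝓢₁ := vacuumCauchyDevelopment.toSpacetime) (𝓢₂ := 𝒟.toSpacetime) ψ hiso hτ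
      minkowskiDecomp with hd₂
  have hO : ψ '' minkowskiExterior = exteriorOf 𝒟.toCauchyDevelopment d₂.charted := by
    rw [hd₂, charted_transportDecomposition, ← image_exteriorOf ψ hiso hτ hι]
    exact congrArg (Set.image ψ) minkowskiExterior_eq_exteriorOf
  have hrays : RaysStayInClosure 𝒟.toCauchyDevelopment (ψ '' minkowskiExterior) :=
    stub_raysStayInClosure_transport _ trivialData vacuumCauchyDevelopment 𝒟 ψ hiso hτ hι
      (fun p γ dom ↦ stub_rayTransport _ trivialData vacuumCauchyDevelopment 𝒟 ψ hiso hτ hι p γ dom)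
      minkowskiExterior raysStayInClosure_minkowski
  have hex : HasExhaustiveCharts d₂ :=
    hasExhaustiveCharts_transportDecomposition _ hiso hτ minkowskiDecomp hasExhaustiveCharts_minkowskiDecomp
  obtain ⟨R, hR, hgrow, hexh⟩ := hex
  -- no hole: the hole-indexed clauses are vacuous
  haveI : IsEmpty (Fin d₂.N) := Fin.isEmpty'
  -- chart orientation rides along the isometry (chain rule + O'Neill's timecone lemma, as in
  -- `DrainImpliesDisperse.Negative.isFutureOriented_transportDecomposition_of_isIsometry`, whose module the farm has not built)
  have hfo : IsFutureOriented d₂ := by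
    -- one chart `Ψ : U → ℝ⁴`: `d(ψ ∘ Ψ) v = dψ (dΨ v)` is future-directed causal when `dΨ v` is
    have step : ∀ {U : TopologicalSpace.Opens E4} {Ψ : U → vacuumCauchyDevelopment.carrier},
        ContMDiff 𝓘(ℝ, E4) (𝓡 4) ∞ Ψ → ∀ {x : U} {v : E4},
          vacuumCauchyDevelopment.timeOrientation.IsFutureDirected (mfderiv 𝓘(ℝ, E4) (𝓡 4) Ψ x v) →
            𝒟.timeOrientation.IsFutureDirected (mfderiv 𝓘(ℝ, E4) (𝓡 4) (ψ ∘ Ψ) x v) := by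
      intro U Ψ hΨ x v hv
      have hc : MDifferentiableAt 𝓘(ℝ, E4) (𝓡 4) Ψ x := (hΨ.mdifferentiable (by simp)) x
      rw [mfderiv_comp x (mdifferentiable_diffeomorph ψ _) hc]
      exact hτ.isFutureDirected_mfderiv hiso hv
    refine ⟨fun i => isEmptyElim i, fun i => isEmptyElim i, ?_⟩
    exact isFutureOriented_minkowskiDecomp.2.2.mono fun τ hτ' x hx =>
      step minkowskiDecomp.isLateChart_flat.contMDiff (hτ' x hx)
  -- flat zone: the transported identity chart has ZERO deviation at every order
  have hflat : ∀ k, Tendsto (fun τ => 𝒟.toSpacetime.deviationCk (Minkowski.backgroundOn d₂.flatDomain) d₂.flatChart k τ)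
      atTop (𝓝 0) := by
    intro k
    have h1 : Tendsto (fun τ => Minkowski.spacetime.deviationCk (Minkowski.backgroundOn ⊤) idFlatChart k τ) atTop (𝓝 0) :=
      tendsto_const_nhds.congr fun τ => (deviationCk_idFlatChart_eq_zero k τ).symm
    refine h1.congr fun τ => ?_
    exact (deviationCk_comp ψ _ minkowskiDecomp.isLateChart_flat.contMDiff hiso k τ).symm
  exact era_of_settledAllOrders 𝒟 (ψ '' minkowskiExterior) d₂ (fun i => isEmptyElim i) hO hrays hfo hflat
    (fun i => isEmptyElim i) R hR (fun i => isEmptyElim i) hexh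

/-- **The trivial datum is NOT exceptional for the crux** (`X = ℝ³ = Minkowski.slice`): it does not lie in the set
`{d ∈ admissibleVacuumData ℝ³ | ¬ P d}` whose tame codimension `≥ 1` the crux `LogTimeThreeAnnuli.SubconvergentEraGeneric`
asserts.  (It IS admissible, `trivialData_mem_admissibleVacuumData`; it fails the second membership clause by
`subconvergentEraProperty_trivialData`.)  [cite: Christodoulou1999, p. A24] -/
theorem trivialData_not_exceptional :
    trivialData ∉ {D ∈ admissibleVacuumData Minkowski.slice | ¬ ∀ 𝒟 : VacuumCauchyDevelopment D, 𝒟.IsMaximal → HasCompleteNullInfinity 𝒟.toCauchyDevelopment ∧ (∃ (m₀ χ : ℝ) (O : Set 𝒟.carrier) (d : QuasiFinalStateDecomposition 𝒟.toSpacetime O 2 ⊤) (R : Fin d.N → ℝ → ℝ), 0 < m₀ ∧ χ < 1 ∧ O = exteriorOf 𝒟.toCauchyDevelopment d.charted ∧ RaysStayInClosure 𝒟.toCauchyDevelopment O ∧ (∀ i, Tendsto (R i) atTop atTop ∧ ∀ τ, max (Kerr.rPlus (d.mass i) (d.spin i)) 0 + 1 ≤ R i τ) ∧ (∀ τ₁,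 d.τ₀ < τ₁ → O \ d.certifiedLate R τ₁ ⊆ 𝒟.metric.causalPast 𝒟.timeOrientation (d.certifiedSlab R τ₁)) ∧ (∀ i, IsOrthochronous (d.motion i).1) ∧ (∀ i (ρ : ℝ), ∀ᶠ τ in atTop, ∀ x ∈ (d.background i).truncTimeSlab ρ τ, ∀ w : E4, 𝒟.timeOrientation.IsFutureDirected (mfderiv 𝓘(ℝ, E4) (𝓡 4) (d.chart i) x w) → 0 < ((d.motion i).1 : E4 ≃L[ℝ] E4).symm w 0) ∧ (∀ᶠ τ in atTop, ∀ x ∈ (Minkowski.backgroundOn d.flatDomain).timeSlab τ, 𝒟.timeOrientation.IsFutureDirected (mfderiv 𝓘(ℝ, E4) (𝓡 4) d.flatChart x (E4.basisVector 0))) ∧ (∀ k, Tendsto (fun τ => 𝒟.toSpacetime.deviationCk (Minkowski.backgroundOn d.flatDomain) d.flatChart k τ) atTop (𝓝 0)) ∧ (∀ i k (ρ : ℝ) (ε : ℝ≥0∞), 0 < ε → ∀ᶠ τ in atTop, ∃ M a, m₀ ≤ M ∧ M ≤ m₀⁻¹ ∧ |a| ≤ χ * M ∧ 𝒟.toSpacetime.truncDeviationCk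 ⟨(d.background i).domain, boostedKerrBilin (d.motion i).1 (d.motion i).2 M a, (d.background i).time, (d.background i).radius⟩ (d.chart i) k ρ τ ≤ ε ∧ 𝒟.toSpacetime.truncDeviationCk ⟨(d.background i).domain, boostedKerrBilin (d.motion i).1 (d.motion i).2 M a, (d.background i).time, (d.background i).radius⟩ (d.chart i) k (R i τ) τ ≤ ε))} :=
  fun h => h.2 subconvergentEraProperty_trivialData

/-- **Anti-vacuity of the crux's conclusion predicate at a certified MGHD.**  Given the Choquet-Bruhat–Geroch existence
theorem (used ONLY for the conjunct "an MGHD exists": Minkowski space is then an MGHD of the trivial datum,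
`Minkowski.isMaximal_vacuumCauchyDevelopment`), there is an admissible datum on `ℝ³` possessing a maximal vacuum Cauchy
development and satisfying the crux's property `P` (unconditionally in its `∀ MGHD` part, `subconvergentEraProperty_trivialData`).
So the thirteen era clauses are jointly satisfiable, verbatim, at an honest maximal development of an admissible datum — the
hand-back curves demanded by the residual stub C₂' are asked to consist of data of an INHABITED kind.
[cite: ChoquetBruhatGeroch1969CMP, Thm. 3] -/
theorem exists_admissible_isMaximal_subconvergentEraProperty (hcbg : choquetBruhat_geroch_exists_mghd_cauchy) :
    ∃ D ∈ admissibleVacuumData Minkowski.slice, (∃ 𝒟 : VacuumCauchyDevelopment D, 𝒟.IsMaximal) ∧ ∀ 𝒟 : VacuumCauchyDevelopment D, 𝒟.IsMaximal → HasCompleteNullInfinity 𝒟.toCauchyDevelopment ∧ (∃ (m₀ χ : ℝ) (O : Set 𝒟.carrier) (d : QuasiFinalStateDecomposition 𝒟.toSpacetime O 2 ⊤) (R : Fin d.N → ℝ → ℝ), 0 < m₀ ∧ χ < 1 ∧ O = exteriorOf 𝒟.toCauchyDevelopment d.charted ∧ RaysStayInClosure 𝒟.toCauchyDevelopment O ∧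 (∀ i, Tendsto (R i) atTop atTop ∧ ∀ τ, max (Kerr.rPlus (d.mass i) (d.spin i)) 0 + 1 ≤ R i τ) ∧ (∀ τ₁, d.τ₀ < τ₁ → O \ d.certifiedLate R τ₁ ⊆ 𝒟.metric.causalPast 𝒟.timeOrientation (d.certifiedSlab R τ₁)) ∧ (∀ i, IsOrthochronous (d.motion i).1) ∧ (∀ i (ρ : ℝ), ∀ᶠ τ in atTop, ∀ x ∈ (d.background i).truncTimeSlab ρ τ, ∀ w : E4, 𝒟.timeOrientation.IsFutureDirected (mfderiv 𝓘(ℝ, E4) (𝓡 4) (d.chart i) x w) → 0 < ((d.motion i).1 : E4 ≃L[ℝ] E4).symm w 0) ∧ (∀ᶠ τ in atTop, ∀ x ∈ (Minkowski.backgroundOn d.flatDomain).timeSlab τ, 𝒟.timeOrientation.IsFutureDirected (mfderiv 𝓘(ℝ, E4) (𝓡 4) d.flatChart x (E4.basisVector 0))) ∧ (∀ k, Tendsto (fun τ => 𝒟.toSpacetime.deviationCk (Minkowski.backgroundOn d.flatDomain) d.flatChart k τ) atTop (𝓝 0)) ∧ (∀ i k (ρ : ℝ) (ε : ℝ≥0∞),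 0 < ε → ∀ᶠ τ in atTop, ∃ M a, m₀ ≤ M ∧ M ≤ m₀⁻¹ ∧ |a| ≤ χ * M ∧ 𝒟.toSpacetime.truncDeviationCk ⟨(d.background i).domain, boostedKerrBilin (d.motion i).1 (d.motion i).2 M a, (d.background i).time, (d.background i).radius⟩ (d.chart i) k ρ τ ≤ ε ∧ 𝒟.toSpacetime.truncDeviationCk ⟨(d.background i).domain, boostedKerrBilin (d.motion i).1 (d.motion i).2 M a, (d.background i).time, (d.background i).radius⟩ (d.chart i) k (R i τ) τ ≤ ε)) :=
  ⟨trivialData, trivialData_mem_admissibleVacuumData,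
    ⟨vacuumCauchyDevelopment, Minkowski.isMaximal_vacuumCauchyDevelopment hcbg⟩, subconvergentEraProperty_trivialData⟩

end Summit.FinalStateConjecture.FinalStateConjecture.Theorems.LogTimeThreeAnnuli.SubconvergentEraGeneric

end
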